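import Summits.KontsevichZagierPeriods.KontsevichZagierPeriods.Theses.HermiteRigidity

/-!
# `EllipticMomentKernel` (stmt-KontsevichZagierPeriods-10631) — negative knowledge, part 1: vocabulary and load-bearing hypotheses

Support file for the crux `HermiteRigidity.EllipticMomentKernel` (cdisprove seat, gen 1; work file
`Cruxes/EllipticMomentKernel/Disproof.lean`). Contents: the named pieces of the crux (`cubic`,
`disc`, `oval`, `J0`, `J1`, `Rigid`, `underGraph`, `gens = gens₂ ∪ gens₁`, `KernelClaim`) and the
DEFINITIONAL unfolding `ellipticMomentKernel_iff`; then the load-bearing analysis of the two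
hypotheses: `0 < disc` is DECORATION (`ellipticMomentKernel_iff_withoutDisc`, via
`Rigid → J₀ ≠ 0 → σ ≠ ∅ → disc > 0`, and conversely `oval_nonempty_iff`), while `Rigid` is
load-bearing for the proof only (`EllipticMomentKernelWithoutRigidity` implies the crux and follows
from it plus Masser's theorem in the form `∀ q₂ q₃, 0 < disc → Rigid`). Finally
`not_ellipticMomentKernel_iff`: what a refutation would have to exhibit (a curve with PROVED
rigidity and a value-`0` non-relation). [folklore]
-/

noncomputable section

open MeasureTheory Set
open scoped BigOperators

namespace Summit.KontsevichZagierPeriods.HermiteRigidity.EllipticMomentKernelNegative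

open Literature.NumberTheory.Transcendental
open Literature.NumberTheory.Transcendental.KZ
open Summit.KontsevichZagierPeriods.KontsevichZagierPeriods.Theses.HermiteRigidity (EllipticMomentKernel)

/-! ## §1 Vocabulary and unfolding -/

/-- The Weierstrass cubic `f(x) = 4x³ − q₂x − q₃`. [folklore] -/
def cubic (q₂ q₃ : ℚ) (x : ℝ) : ℝ := 4 * x ^ 3 - (q₂ : ℝ) * x - (q₃ : ℝ)

/-- Its discriminant (up to the factor 16): `q₂³ − 27q₃²`. [folklore] -/
def disc (q₂ q₃ : ℚ) : ℝ := (q₂ : ℝ) ^ 3 - 27 * (q₃ : ℝ) ^ 2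

/-- The bounded real oval `σ = {f > 0} ∩ {∃ t > x, f t < 0}` (`= (e₃, e₂)` when `disc > 0`),
as a subset of `ℝ¹`. [folklore] -/
def oval (q₂ q₃ : ℚ) : Set (Fin 1 → ℝ) :=
  {p | 0 < cubic q₂ q₃ (p 0) ∧ ∃ t : ℝ, p 0 < t ∧ cubic q₂ q₃ t < 0}

/-- `J₀ = ∫_σ dx/√f`. [folklore] -/
def J0 (q₂ q₃ : ℚ) : ℝ := ∫ p in oval q₂ q₃, 1 / Real.sqrt (cubic q₂ q₃ (p 0))

/-- `J₁ = ∫_σ x dx/√f`. [folklore] -/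
def J1 (q₂ q₃ : ℚ) : ℝ := ∫ p in oval q₂ q₃, p 0 / Real.sqrt (cubic q₂ q₃ (p 0))

/-- The INLINED rigidity hypothesis of the crux: `1, J₀, J₁` are linearly independent over the
real algebraic numbers. [cite: Masser1975, Thm II/III] -/
def Rigid (q₂ q₃ : ℚ) : Prop :=
  ∀ a b c : ℝ, IsAlgebraic ℚ a → IsAlgebraic ℚ b → IsAlgebraic ℚ c →
    a + b * J0 q₂ q₃ + c * J1 q₂ q₃ = 0 → a = 0 ∧ b = 0 ∧ c = 0

/-- The region under the graph of `√f` over the oval, `D ⊆ ℝ²`. [folklore] -/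
def underGraph (q₂ q₃ : ℚ) : Set (Fin 2 → ℝ) :=
  {p | (0 < cubic q₂ q₃ (p 0) ∧ ∃ t : ℝ, p 0 < t ∧ cubic q₂ q₃ t < 0) ∧
    0 < p 1 ∧ p 1 ^ 2 < cubic q₂ q₃ (p 0)}

/-- The 2-dimensional generators `[D, x^a y^b]`. [folklore] -/
def gens₂ (q₂ q₃ : ℚ) : Set FormalRep :=
  {c | ∃ (r : IntegralRep 2) (a b : ℕ), r.domain = underGraph q₂ q₃ ∧
    EqOn r.integrand (fun p => p 0 ^ a * p 1 ^ b) (underGraph q₂ q₃) ∧ c = KZ.of r}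

/-- The 1-dimensional generators `[σ, x^m/√f]`. [folklore] -/
def gens₁ (q₂ q₃ : ℚ) : Set FormalRep :=
  {c | ∃ (r : IntegralRep 1) (m : ℕ), r.domain = oval q₂ q₃ ∧
    EqOn r.integrand (fun p => p 0 ^ m / Real.sqrt (cubic q₂ q₃ (p 0))) (oval q₂ q₃) ∧
    c = KZ.of r}

/-- All generators of the elliptic moment sector. [folklore] -/
def gens (q₂ q₃ : ℚ) : Set FormalRep := gens₂ q₂ q₃ ∪ gens₁ q₂ q₃

/-- The kernel claim on the sector: every `ℤ`-combination of generators of value `0` is a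
relation of the KZ calculus. [cite: KontsevichZagier2001, §1.2] -/
def KernelClaim (q₂ q₃ : ℚ) : Prop :=
  ∀ c ∈ AddSubgroup.closure (gens q₂ q₃), KZ.eval c = 0 → c ∈ KZ.relations

/-- The crux, unfolded into the vocabulary above (definitional). [folklore] -/
theorem ellipticMomentKernel_iff :
    EllipticMomentKernel ↔ ∀ q₂ q₃ : ℚ, 0 < disc q₂ q₃ → Rigid q₂ q₃ → KernelClaim q₂ q₃ :=
  Iff.rfl


/-! ## §2 Load-bearing analysis of the two hypotheses `0 < disc` and `Rigid` -/

section LoadBearing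

variable {q₂ q₃ : ℚ}

/-- The cubic is continuous. [folklore] -/
theorem continuous_cubic : Continuous (cubic q₂ q₃) := by
  unfold cubic; fun_prop

/-- Factorisation of the cubic through a root. [folklore] -/
theorem cubic_eq_mul_of_root {e : ℝ} (he : cubic q₂ q₃ e = 0) (x : ℝ) :
    cubic q₂ q₃ x = (x - e) * (4 * x ^ 2 + 4 * e * x + (4 * e ^ 2 - q₂)) := by
  unfold cubic at *
  linear_combination he

/-- The discriminant through a root: `disc = (q₂ − 3e²)(12e² − q₂)²`. [folklore] -/
theorem disc_eq_of_root {e : ℝ} (he : cubic q₂ q₃ e = 0) :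
    disc q₂ q₃ = ((q₂ : ℝ) - 3 * e ^ 2) * (12 * e ^ 2 - q₂) ^ 2 := by
  unfold cubic at he
  unfold disc
  have h : (q₃ : ℝ) = 4 * e ^ 3 - q₂ * e := by linarith
  rw [h]; ring

/-- RIGIDITY FORCES `J₀ ≠ 0` (take `(a, b, c) = (0, 1, 0)`). [folklore] -/
theorem J0_ne_zero_of_rigid (h : Rigid q₂ q₃) : J0 q₂ q₃ ≠ 0 := by
  intro h0
  have := (h 0 1 0 isAlgebraic_zero isAlgebraic_one isAlgebraic_zero (by rw [h0]; ring)).2.1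
  exact one_ne_zero this

/-- RIGIDITY FORCES THE OVAL TO BE NON-EMPTY (an empty oval has `J₀ = 0`). [folklore] -/
theorem oval_nonempty_of_rigid (h : Rigid q₂ q₃) : (oval q₂ q₃).Nonempty := by
  by_contra hne
  rw [Set.not_nonempty_iff_eq_empty] at hne
  exact J0_ne_zero_of_rigid h (by simp [J0, hne])

/-- A sign change `f x > 0 > f t` with `x < t` of the depressed cubic forces three distinct real
roots, i.e. `disc > 0`: through the root `e ∈ (x, t)` one has `f = (· − e)·Q` with
`Q x < 0`, `Q t < 0`, whence `q₂ > (2x + e)² + 3e² ≥ 3e²`, and `12e² = q₂` would make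
`Q = 4(· − e)(· + 2e)` negative at both `x < t` on opposite sides of `−2e`. [folklore] -/
theorem disc_pos_of_sign_change {x t : ℝ} (hxt : x < t) (hx : 0 < cubic q₂ q₃ x)
    (ht : cubic q₂ q₃ t < 0) : 0 < disc q₂ q₃ := by
  obtain ⟨e, ⟨hxe, het⟩, he⟩ : ∃ e ∈ Icc x t, cubic q₂ q₃ e = 0 :=
    intermediate_value_Icc' hxt.le continuous_cubic.continuousOn ⟨ht.le, hx.le⟩
  have hxe' : x < e := lt_of_le_of_ne hxe (by rintro rfl; exact hx.ne' he)
  have het' : e < t := lt_of_le_of_ne het (by rintro rfl; exact ht.ne he)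
  have hQx : 4 * x ^ 2 + 4 * e * x + (4 * e ^ 2 - q₂) < 0 := by
    have h1 : cubic q₂ q₃ x = (x - e) * (4 * x ^ 2 + 4 * e * x + (4 * e ^ 2 - q₂)) :=
      cubic_eq_mul_of_root he x
    by_contra hcon
    push Not at hcon
    have : (x - e) * (4 * x ^ 2 + 4 * e * x + (4 * e ^ 2 - q₂)) ≤ 0 :=
      mul_nonpos_of_nonpos_of_nonneg (by linarith) hcon
    linarith
  have hQt : 4 * t ^ 2 + 4 * e * t + (4 * e ^ 2 - q₂) < 0 := by
    have h1 : cubic q₂ q₃ t = (t - e) * (4 * t ^ 2 + 4 * e * t + (4 * e ^ 2 - q₂)) :=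
      cubic_eq_mul_of_root he t
    by_contra hcon
    push Not at hcon
    have : 0 ≤ (t - e) * (4 * t ^ 2 + 4 * e * t + (4 * e ^ 2 - q₂)) :=
      mul_nonneg (by linarith) hcon
    linarith
  rw [disc_eq_of_root he]
  have hA : 0 < (q₂ : ℝ) - 3 * e ^ 2 := by nlinarith [sq_nonneg (2 * x + e)]
  have hB : 12 * e ^ 2 - (q₂ : ℝ) ≠ 0 := by
    intro hB
    have hq : (q₂ : ℝ) = 12 * e ^ 2 := by linarith
    rw [hq] at hQx hQt
    have hx2 : 0 < x + 2 * e := by nlinarith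
    have ht2 : t + 2 * e < 0 := by nlinarith
    linarith
  have hB2 : 0 < (12 * e ^ 2 - (q₂ : ℝ)) ^ 2 := by positivity
  exact mul_pos hA hB2

/-- A non-empty oval forces `disc > 0`. [folklore] -/
theorem disc_pos_of_oval_nonempty (h : (oval q₂ q₃).Nonempty) : 0 < disc q₂ q₃ := by
  obtain ⟨p, hp, t, hpt, ht⟩ := h
  exact disc_pos_of_sign_change hpt hp ht

/-- **The discriminant hypothesis is implied by the rigidity hypothesis.** [folklore] -/
theorem disc_pos_of_rigid (h : Rigid q₂ q₃) : 0 < disc q₂ q₃ :=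
  disc_pos_of_oval_nonempty (oval_nonempty_of_rigid h)

/-- Conversely the oval is non-empty as soon as `disc > 0`: with `m = √(q₂/12)` one has
`f(−m) = (2/3)q₂m − q₃ > 0 > −(2/3)q₂m − q₃ = f(m)` because `((2/3)q₂m)² = q₂³/27 > q₃²`.
So NEITHER hypothesis is vacuous on the discriminant side. [folklore] -/
theorem neg_sqrt_mem_oval (h : 0 < disc q₂ q₃) :
    (fun _ => -Real.sqrt (q₂ / 12) : Fin 1 → ℝ) ∈ oval q₂ q₃ := by
  unfold disc at h
  have hq : (0 : ℝ) < q₂ := by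
    by_contra hle
    push Not at hle
    have h3 : (q₂ : ℝ) ^ 3 ≤ 0 := by
      have : (q₂ : ℝ) ^ 3 = q₂ * q₂ ^ 2 := by ring
      rw [this]; exact mul_nonpos_of_nonpos_of_nonneg hle (sq_nonneg _)
    nlinarith [sq_nonneg (q₃ : ℝ)]
  set m := Real.sqrt (q₂ / 12) with hm
  have hm2 : m ^ 2 = q₂ / 12 := Real.sq_sqrt (by positivity)
  have hm0 : 0 < m := Real.sqrt_pos.2 (by positivity)
  have hfm : cubic q₂ q₃ (-m) = 2 / 3 * q₂ * m - q₃ := by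
    unfold cubic; linear_combination (-4 * m) * hm2
  have hfp : cubic q₂ q₃ m = -(2 / 3 * q₂ * m) - q₃ := by
    unfold cubic; linear_combination (4 * m) * hm2
  have hkey : (q₃ : ℝ) ^ 2 < (2 / 3 * q₂ * m) ^ 2 := by
    have : (2 / 3 * (q₂ : ℝ) * m) ^ 2 = (q₂ : ℝ) ^ 3 / 27 := by
      rw [mul_pow, hm2]; ring
    rw [this]; nlinarith
  have hpos : 0 < 2 / 3 * (q₂ : ℝ) * m := by positivity
  have hq3 : |(q₃ : ℝ)| < 2 / 3 * q₂ * m := abs_lt_of_sq_lt_sq hkey hpos.le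
  have hq3' := abs_lt.1 hq3
  refine ⟨?_, m, ?_, ?_⟩
  · show 0 < cubic q₂ q₃ (-m)
    rw [hfm]; linarith
  · show -m < m
    linarith
  · rw [hfp]; linarith

/-- The oval is non-empty iff `disc > 0`. [folklore] -/
theorem oval_nonempty_iff : (oval q₂ q₃).Nonempty ↔ 0 < disc q₂ q₃ :=
  ⟨disc_pos_of_oval_nonempty, fun h => ⟨_, neg_sqrt_mem_oval h⟩⟩

end LoadBearing

/-- The crux with the discriminant hypothesis DROPPED (a statement variant of the crux for the
load-bearing analysis, not a literature fact). -/
def EllipticMomentKernelWithoutDisc : Prop :=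
  ∀ q₂ q₃ : ℚ, Rigid q₂ q₃ → KernelClaim q₂ q₃

/-- **`0 < disc` is decoration**: dropping it does not change the statement, because the inlined
rigidity hypothesis already forces `J₀ ≠ 0`, hence a non-empty oval, hence three real roots
(`disc_pos_of_rigid`). So NO `_false_without_disc` theorem exists; the hypothesis only serves to
identify `σ = (e₃, e₂)`. [folklore] -/
theorem ellipticMomentKernel_iff_withoutDisc :
    EllipticMomentKernel ↔ EllipticMomentKernelWithoutDisc :=
  ⟨fun h q₂ q₃ hr => ellipticMomentKernel_iff.mp h q₂ q₃ (disc_pos_of_rigid hr) hr,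
    fun h q₂ q₃ _ hr => h q₂ q₃ hr⟩

/-- The crux with the rigidity hypothesis DROPPED: the unconditional kernel conjecture on the
elliptic moment sector of every rational cubic with three real roots (a statement variant of the
crux for the load-bearing analysis, not a literature fact). -/
def EllipticMomentKernelWithoutRigidity : Prop :=
  ∀ q₂ q₃ : ℚ, 0 < disc q₂ q₃ → KernelClaim q₂ q₃

/-- Dropping the rigidity hypothesis STRENGTHENS the crux … [folklore] -/
theorem ellipticMomentKernel_of_withoutRigidity :
    EllipticMomentKernelWithoutRigidity → EllipticMomentKernel :=
  fun h q₂ q₃ hd _ => h q₂ q₃ hd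

/-- … and the strengthening is recovered from the crux plus Masser's theorem in the form
`∀ q₂ q₃, 0 < disc → Rigid q₂ q₃` (Masser 1975 Thm II (non-CM) / Thm III + Lemma 3.1 (CM):
`1, ω₁, η₁` are linearly independent over `ℚ̄` for algebraic `g₂, g₃`; dictionary `J₀ = ω₁/2` —
tree: `PeriodPair.IsReal.integral_inv_sqrt_cubic_of_discr_pos_holds` — and `J₁ = −η₁/2`, Lawden
(6.13.3), not yet in the tree). Hence `Rigid` is load-bearing for the PROOF (it replaces a
transcendence theorem), not for TRUTH: `EllipticMomentKernelWithoutRigidity` is not refutable by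
any means available here, and no `_false_without_rigid` theorem is claimed.
[cite: Masser1975, Thm II/III] -/
theorem withoutRigidity_of_masser (hM : ∀ q₂ q₃ : ℚ, 0 < disc q₂ q₃ → Rigid q₂ q₃) :
    EllipticMomentKernel → EllipticMomentKernelWithoutRigidity :=
  fun h q₂ q₃ hd => ellipticMomentKernel_iff.mp h q₂ q₃ hd (hM q₂ q₃ hd)

/-- **What a kill would have to produce** (pure logic, using `disc`-redundancy): a rational cubic
whose rigidity is PROVED (Schneider/Masser-type transcendence inside Lean) together with a
value-`0` combination of sector generators that is NOT a relation — i.e. an additive invariant of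
`KZ.relations` finer than `KZ.eval` (`relations ≤ ker eval` is the tree's
`KZ.relations_le_ker_eval_holds`). Neither ingredient is available; see the file docblock.
[folklore] -/
theorem not_ellipticMomentKernel_iff :
    ¬ EllipticMomentKernel ↔ ∃ q₂ q₃ : ℚ, Rigid q₂ q₃ ∧
      ∃ c ∈ AddSubgroup.closure (gens q₂ q₃), KZ.eval c = 0 ∧ c ∉ KZ.relations := by
  rw [ellipticMomentKernel_iff_withoutDisc]
  unfold EllipticMomentKernelWithoutDisc KernelClaim
  push Not
  rfl

end Summit.KontsevichZagierPeriods.HermiteRigidity.EllipticMomentKernelNegative
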